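import Summits.BirchSwinnertonDyer.BirchSwinnertonDyer.Theorems.UniversalToricDescentSigmaCongruenceAtThreeIffInvariantPair
import HarnessLib

/-!
# SKELETON (line `sqrt-toric-functional`, crux-strategist `cstrat-stmt-BirchSwinnertonDyer-27120` g0, 2026-08-29) for the crux
# A = `SigmaCongruenceAtThree` (stmt-BirchSwinnertonDyer-27120, route `UniversalToricDescent`; stub A of the parent line
# `Cruxes/DefectTransportModThreePT/Lines/sigmacongruence.lean` v10 of ♭T≤ = stmt-23042)

LEVER (one sentence). Greenberg–Vatsal transport at the additive split prime `3` is LINEARITY of ONE additive functional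
`Θ : (q-expansion sequences) → R₀⟦T⟧` — the square-root toric (Katz/BDP CM-sum) measure at a common tame level — whose values
on the two `(3NN′)`-DEPLETED eigen-sequences `n ↦ a_n(E)·𝟙_{(n,3NN′)=1}`, `n ↦ a_n(E′)·𝟙` are SQUARE ROOTS of the Σ-depleted
frames `𝓛·Π_E(e)`, `𝓛′·Π_{E′}(e)` of A up to a NON-ZERO CONSTANT and a unit (`C a·(𝓛Π_E(e)) = C b·(w·Θ(g_E)²)` in `R₀⟦T⟧`),
with `μ(Θ g_{E′}) = 0` on the TAME twin side only.  Then `Θ g_E − Θ g_{E′} = Θ(g_E − g_{E′}) = 3·Θ h` is a congruence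
for free (Hecke congruence of the depleted q-expansions, stub H), norm profiles are blind to the constants `a, b, a′, b′`
(lemma `profile_eq_of_C_mul_eq`: two non-zero constant multiples of series with profiles `M, M′` can only be equal if
`M = M′`), and A follows in its λ-identity form (`sigmaCongruenceAtThree_iff_lambdaIdentity_of_thmB`, p705895) — NO
normalisation constant at `27 ∣ N` is ever evaluated, and the exponents `e_v` are the stub's to choose (A leaves them free:
the mirror choice `e_{v̄} := e_v` makes `Π_E(e) = ∏_ℓ P_{𝔩̄}(E)²` a perfect square, matching the one-place depletion factor of
the square-root measure).

POSITION relative to the crux's idea cards (all read 2026-08-29): this is the TYPED CHILD that `Ideas/lambda-scale-blind.md`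
(cruxidea-1 g0, NODE `NodeLambdaScaleBlind.lean`) asks for — its piece C⁺ `ScaledSigmaCongruenceAtThree` is EQUIV to A and its
children Kα (shape) / Kβ (linearity) / Kγ (twin) are informal because "Θ^Σ_E has no Lean object"; here Kα ∧ Kβ ∧ Kγ are ONE typed
statement over EXISTING declarations by three devices: (i) square-root currency (the avatar is a square root of the frame, so the
depletion bookkeeping is one-place and exact), (ii) the functional is a WITNESS `Θ : (ℕ → ℤ) →+ R₀⟦T⟧` on q-expansion sequences,
so linearity is structural and the congruence Kβ is a consequence of the Hecke congruence (stub H) — no `p`-adic modular form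
object is needed in the STATEMENT (it is needed in the PROOF), (iii) the mirror-exponent identity in `R₀⟦T⟧` with constants
`a, b ∈ R₀ ∖ {0}` instead of scalars `z ∈ ℂ₃ˣ` (no `ScaleForcing` step: profiles are compared, never units).  Versus
`deep-conductor-stability` (T1: identify the frame with a construction at `27 ∣ N` INCLUDING the unit) and
`rankin-selberg-linearity-transplant` (K3: LMX level factor a unit): the constant is never asked to be a unit; versus the parent
docstring road (B4) likewise.  Dead steps avoided: value congruences at deep ramified CM points (toric sums carry a Gauss-sum
factor of norm `3^{-n/2}`, so "mod 3" is vacuous for conductor `3^n`, `n ≥ 2`) — the functional is compared as a POWER SERIES;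
LMX common level `27M″` (Rem. 4.11 level factor) — no form is moved to level `27M″`, the `27` lives in the `3`-adic level.

STUBS (3) and tags (D-0171): `stub_thmBAnyLevel` [PRINT-BY-NAME = route item 27933 / `closes` binder; leaf ATTACKABLE by citation],
`stub_heckeCongruence` [WEAKER than A · leaf ATTACKABLE, M: traces of Frobenius on `E[3] ≅ E′[3]` + multiplicativity/Hecke
recursion of `WeierstrassCurve.LFunction`], `stub_sqrtToricFunctional` [STRONGER than A (not EQUIV: it asserts the frames are
squares up to constant·unit and that ONE additive functional serves both curves at every congruence depth) · TRANSFER ·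
UNDECIDED→ATTACKABLE-by-port; internal plan = (F1) BDP/Katz square-root CM-sum functional at tame level `lcm(M, M′)·∏ℓ²`
extended additively to all integer sequences (pure-injectivity of `R₀⟦T⟧ ≅ R₀^ℕ`), (F2) wild identification up to a NON-ZERO
constant from the SHAPE of the explicit Waldspurger formula (new vector of supercuspidal `π₃` ⊗ unramified `χ₃`: local toric
integral `= 1`, χ-independent) + Strassman, (F3) twin identification + `μ = 0` of the canonical twin square root (Hsieh Thm. B /
Castella–Hsieh at `3 ∤ N′`, Castella at `3 ‖ N′`)].  Hardest stub: `stub_sqrtToricFunctional` (F1 needs the tame-level Igusa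
tower as a PROOF object).  `SigmaCongruenceAtThree_of` is kernel-checked (no `sorry` outside `stub_*`) and concludes A BY NAME.
Disproof used: none exists for this crux (`ledger crux ls`, 2026-08-29: no `Disproof.lean`, no `Negative/`).
-/

noncomputable section

open scoped Classical

namespace Summit.BirchSwinnertonDyer.BirchSwinnertonDyer.Cruxes.SigmaCongruenceAtThree.SqrtToricFunctional

open NumberField IsDedekindDomain
open Literature.NumberTheory.EllipticCurves Literature.NumberTheory.EllipticCurves.GreenbergVatsal2000
  Summit.BirchSwinnertonDyer.Rank1Residual.X11b
  Summit.BirchSwinnertonDyer.BirchSwinnertonDyer.Theorems.UniversalToricDescentNormProfile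
  Summit.BirchSwinnertonDyer.BirchSwinnertonDyer.Theorems.UniversalToricDescentAcEulerFactor
  Summit.BirchSwinnertonDyer.BirchSwinnertonDyer.Theorems
  Summit.BirchSwinnertonDyer.BirchSwinnertonDyer.Theses.UniversalToricDescent

/-! ### §1 The three stubs -/

/-- **Stub B (PRINT-BY-NAME) — Hsieh's Theorem B at any level** (route item 27933; the `hThmB`-type input of `closes`):
`μ = 0` for a Hsieh frame of the newform itself at the split prime, any level.  Tag: PRINT · leaf (citation).
[cite: Hsieh2014, Thm. B (Doc. Math. 19 (2014) p. 712)] -/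
theorem stub_thmBAnyLevel :
    Literature.NumberTheory.EllipticCurves.Hsieh2014.thmB_exists_isHsiehLFunction_coeff_norm_eq_one_unrPeriod_anyLevel := by
  sorry

/-- **Stub H (Hecke congruence of the depleted q-expansions)** — for `3`-congruent `E′ ∼ E` (`E[3] ≅ E′[3]` as
`Γ_ℚ`-modules) with conductors `N, N′` (minimal models): `a_n(E) ≡ a_n(E′) (mod 3)` for every `n` prime to `3NN′`
(traces of Frobenius on `E[3]` at good `ℓ ∤ 3NN′`, then multiplicativity and the Hecke recursion
`a_{ℓ^{k+1}} = a_ℓ a_{ℓ^k} − ℓ a_{ℓ^{k−1}}` of `WeierstrassCurve.LFunction`).  Tag: WEAKER than A · ATTACKABLE (M).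
Why plausibly true: Eichler–Shimura/Néron–Ogg–Shafarevich folklore. [cite: SilvermanAEC2009, C.21 Remark 21.3; V.2.3.1]
[cite: DiamondShurman2005, Prop. 5.8.5 (Hecke recursion)] -/
theorem stub_heckeCongruence :
      ∀ (W : WeierstrassCurve ℚ) [W.IsElliptic] [W.IsGloballyMinimal] (W' : WeierstrassCurve ℚ) [W'.IsElliptic]
      [W'.IsGloballyMinimal] (N N' : ℕ), W.conductorNorm ℤ = N → W'.conductorNorm ℤ = N' →
      Summit.BirchSwinnertonDyer.Rank1Residual.O6.ModPCongruent W' W 3 →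
      ∀ n : ℕ, Nat.Coprime n (3 * (N * N')) → (3 : ℤ) ∣ W.LFunction n - W'.LFunction n := by
  sorry

/-- **Stub F (the SQUARE-ROOT TORIC FUNCTIONAL — transfer `C⁺`, hardest)** — on A's own binders: there are an ADDITIVE
functional `Θ : (ℕ → ℤ) →+ R₀⟦T⟧` and exponents `e_v ≠ 0` of exact valuation `c_v` such that, for the
`(3NN′)`-depleted eigen-sequences `g_E, g_{E′}` of `E, E′`:
(wild) `C a · (𝓛·Π_E(e)) = C b · (w · (Θ g_E)²)` for some `a, b ∈ R₀ ∖ {0}` and a unit `w` — the frame of `f_E` times A's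
Σ-Euler product is, UP TO A NON-ZERO CONSTANT and a unit, the square of `Θ g_E` (no unit is asserted at `27 ∣ N`);
(twin) the same for `𝓛′·Π_{E′}(e)` and `Θ g_{E′}`; (μ′) `Θ g_{E′}` has a coefficient of norm `1`.
In nature `Θ` = the Katz/BDP square-root CM-sum measure functional at tame level `lcm(N/27, N′/3^{v₃(N′)})·∏_{ℓ∣NN′,ℓ≠3}ℓ²`
(depletion at `ℓ = 𝔩𝔩̄` multiplies it by the ONE-place factor `P_{𝔩̄}`, hence the mirror exponents `e_{𝔩} = e_{𝔩̄}` make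
`Π(e) = ∏P_{𝔩̄}²`), extended additively from the pure subgroup of q-expansions to all of `ℤ^ℕ`; (wild) is the SHAPE of
Waldspurger/BDP's explicit formula at a split supercuspidal place (new vector's Kirillov function `𝟙_{𝒪ˣ}` ⇒ local integral
`1`) + Strassman against the frame's interpolation; (μ′) is Hsieh's Thm. B / Castella–Hsieh for the TAME twin.
Tag: STRONGER than A · TRANSFER · UNDECIDED (ATTACKABLE by port of BDP 2013 §5, Castella–Hsieh 2018 §3, Kriz–Li 2019 §3,
Hsieh 2014 §3 Prop. 3.5 + Thm. B).  Why it might fail: the tame-level Igusa tower / `θ⁻¹` calculus at `p = 3` with `27` in the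
`3`-adic level is a PROOF object the tree lacks (typing cost, not a mathematical obstruction); the constant in (wild) might be
`n`-dependent beyond `c·β^n` (then no frame would exist — excluded by the tree's cross-period rigidity).
[cite: BertoliniDarmonPrasanna2013, Thm. 5.13 and §5.2] [cite: CastellaHsieh2018, §3 (Def. 3.7, Prop. 3.8, Lemma 3.6)]
[cite: KrizLi2019, Thm. 1.16 and §3.1] [cite: Hsieh2014, Prop. 3.5, Thm. B] [cite: GreenbergVatsal2000, Thm. (1.5), §1 (9)] -/
theorem stub_sqrtToricFunctional :
      ∀ (W : WeierstrassCurve ℚ) [W.IsElliptic] [W.IsGloballyMinimal] (W' : WeierstrassCurve ℚ) [W'.IsElliptic]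
      [W'.IsGloballyMinimal] (N N' : ℕ) [NeZero N] [NeZero N'] (K : Type) [Field K] [NumberField K] (Dt :
      Literature.NumberTheory.EllipticCurves.ModularForms.ModularParametrizationData W N) (Dt' :
      Literature.NumberTheory.EllipticCurves.ModularForms.ModularParametrizationData W' N'),
      Summit.BirchSwinnertonDyer.Rank1Residual.Additive.ClassO6 W 3 → W.HasSurjectiveModNGaloisRep 3 →
      W.analyticRank = 1 → W.conductorNorm ℤ = N → Summit.BirchSwinnertonDyer.Rank1Residual.O6.ModPCongruent W' W
      3 → ¬ Literature.NumberTheory.EllipticCurves.Rank1Residual.Addv W' 3 → W'.conductorNorm ℤ = N' →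
      Literature.NumberTheory.EllipticCurves.IsImaginaryQuadratic K →
      Literature.NumberTheory.EllipticCurves.SatisfiesHeegnerHypothesis N K →
      Literature.NumberTheory.EllipticCurves.SatisfiesHeegnerHypothesis N' K → ∀ (κ :
      Literature.NumberTheory.EllipticCurves.ZpExtension K 3), κ.IsAnticyclotomic → ∀ (γ :
      Field.absoluteGaloisGroup K) [Fact (κ.IsTopGenerator γ)] (𝔭 : IsDedekindDomain.HeightOneSpectrum
      (NumberField.RingOfIntegers K)), ((3 : ℕ) : NumberField.RingOfIntegers K) ∈ 𝔭.asIdeal →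
      𝔭.asIdeal.ramificationIdx (NumberField.RingOfIntegers ℚ) = 1 → 𝔭.asIdeal.inertiaDeg
      (NumberField.RingOfIntegers ℚ) = 1 → ∀ (𝔭' : IsDedekindDomain.HeightOneSpectrum (NumberField.RingOfIntegers
      K)), ((3 : ℕ) : NumberField.RingOfIntegers K) ∈ 𝔭'.asIdeal → 𝔭' ≠ 𝔭 → ∀ (ι' : PadicAlgCl 3 ≃+* ℂ),
      Summit.BirchSwinnertonDyer.BirchSwinnertonDyer.Theorems.SchneiderFree.BranchInducesPrime 3 ι' 𝔭 → ∀ (ΩK : ℂ)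
      (Ωp : ℂ_[3]) (L : Literature.NumberTheory.EllipticCurves.UnrSeries 3), ΩK ≠ 0 → Ωp ≠ 0 →
      Literature.NumberTheory.EllipticCurves.IsBDPLFunction ι' 𝔭 κ γ Dt.f ΩK Ωp L → ∀ (ΩK' : ℂ) (Ωp' : ℂ_[3]) (L'
      : Literature.NumberTheory.EllipticCurves.UnrSeries 3), ΩK' ≠ 0 → Ωp' ≠ 0 →
      Literature.NumberTheory.EllipticCurves.IsBDPLFunction ι' 𝔭 κ γ Dt'.f ΩK' Ωp' L' → (∃ i : ℕ,
      ‖((PowerSeries.coeff i L' : Literature.NumberTheory.EllipticCurves.unrIntegers 3) : ℂ_[3])‖ = 1) → ∀ (T :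
      Finset (IsDedekindDomain.HeightOneSpectrum (NumberField.RingOfIntegers K))) (c :
      IsDedekindDomain.HeightOneSpectrum (NumberField.RingOfIntegers K) → ℕ), (↑T = {v :
      IsDedekindDomain.HeightOneSpectrum (NumberField.RingOfIntegers K) | ((3 : ℕ) : NumberField.RingOfIntegers K)
      ∉ v.asIdeal ∧ (¬ (W.baseChange K).HasGoodReductionAt v ∨ ¬ (W'.baseChange K).HasGoodReductionAt v)}) → (∀ v
      ∈ T, (∃ d₀ : Literature.NumberTheory.EllipticCurves.GreenbergSelmer.decomp (K := K) v, (κ (d₀ :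
      Field.absoluteGaloisGroup K)).toAdd = (3 : ℤ_[3]) ^ c v) ∧ (∀ d :
      Literature.NumberTheory.EllipticCurves.GreenbergSelmer.decomp (K := K) v, (3 : ℤ_[3]) ^ c v ∣ (κ (d :
      Field.absoluteGaloisGroup K)).toAdd)) →
      ∃ (Θ : (ℕ → ℤ) →+ Literature.NumberTheory.EllipticCurves.UnrSeries 3)
        (e : IsDedekindDomain.HeightOneSpectrum (NumberField.RingOfIntegers K) → ℤ_[3]),
        (∀ v ∈ T, e v ≠ 0 ∧ (e v).valuation = c v) ∧
        (∃ (a b : Literature.NumberTheory.EllipticCurves.unrIntegers 3)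
            (w : Literature.NumberTheory.EllipticCurves.UnrSeries 3), a ≠ 0 ∧ b ≠ 0 ∧ IsUnit w ∧
          PowerSeries.C a * (L * PowerSeries.map (Summit.BirchSwinnertonDyer.Rank1Residual.X11b.Halves.toUnr 3)
            (∏ v ∈ T, (Polynomial.aeval
              (PowerSeries.C ((Nat.card (IsLocalRing.ResidueField (v.adicCompletionIntegers K)) : ℤ_[3]).inv) *
                PowerSeries.binomialSeries ℤ_[3] (e v)) ((W.baseChange K).localPolynomialAt v) :
              Literature.NumberTheory.EllipticCurves.IwasawaAlgebra 3))) =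
          PowerSeries.C b * (w * Θ (fun n : ℕ ↦ if Nat.Coprime n (3 * (N * N')) then W.LFunction n else 0) ^ 2)) ∧
        (∃ (a' b' : Literature.NumberTheory.EllipticCurves.unrIntegers 3)
            (w' : Literature.NumberTheory.EllipticCurves.UnrSeries 3), a' ≠ 0 ∧ b' ≠ 0 ∧ IsUnit w' ∧
          PowerSeries.C a' * (L' * PowerSeries.map (Summit.BirchSwinnertonDyer.Rank1Residual.X11b.Halves.toUnr 3)
            (∏ v ∈ T, (Polynomial.aeval
              (PowerSeries.C ((Nat.card (IsLocalRing.ResidueField (v.adicCompletionIntegers K)) : ℤ_[3]).inv) *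
                PowerSeries.binomialSeries ℤ_[3] (e v)) ((W'.baseChange K).localPolynomialAt v) :
              Literature.NumberTheory.EllipticCurves.IwasawaAlgebra 3))) =
          PowerSeries.C b' * (w' * Θ (fun n : ℕ ↦ if Nat.Coprime n (3 * (N * N')) then W'.LFunction n else 0) ^ 2)) ∧
        (∃ i : ℕ, ‖((PowerSeries.coeff i (Θ (fun n : ℕ ↦ if Nat.Coprime n (3 * (N * N')) then W'.LFunction n else 0)) :
          Literature.NumberTheory.EllipticCurves.unrIntegers 3) : ℂ_[3])‖ = 1) := by
  sorry

/-! ### §2 Profile algebra: constants are invisible to norm profiles -/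

/-- `0 < ‖3‖ < 1` in `ℂ₃`. [folklore] -/
theorem norm_three_lt_one : ‖((3 : ℕ) : ℂ_[3])‖ < 1 := by
  haveI : Fact (Nat.Prime 3) := ⟨Nat.prime_three⟩
  have h : ‖((3 : ℕ) : ℂ_[3])‖ = ‖((3 : ℕ) : ℚ_[3])‖ := by
    rw [← map_natCast (algebraMap ℚ_[3] ℂ_[3]) 3, norm_algebraMap']
  rw [h]
  exact Padic.norm_p_lt_one

/-- **Two non-zero constant multiples of series with norm profiles `M, M′` are equal only if `M = M′`** (the constants are
never compared with units: at the index `min(M, M′)` one side has norm `‖a‖`, the other `< ‖b‖`, at `max` the reverse).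
[cite: Washington1997, §7.1] -/
theorem profile_eq_of_C_mul_eq {X Y : UnrSeries 3} {a b : unrIntegers 3} {M M' : ℕ} (ha : a ≠ 0) (hb : b ≠ 0)
    (hX : (∀ i < M, ‖((PowerSeries.coeff i X : unrIntegers 3) : ℂ_[3])‖ < 1) ∧
      ‖((PowerSeries.coeff M X : unrIntegers 3) : ℂ_[3])‖ = 1)
    (hY : (∀ i < M', ‖((PowerSeries.coeff i Y : unrIntegers 3) : ℂ_[3])‖ < 1) ∧
      ‖((PowerSeries.coeff M' Y : unrIntegers 3) : ℂ_[3])‖ = 1)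
    (h : PowerSeries.C a * X = PowerSeries.C b * Y) : M = M' := by
  have key : ∀ i, ‖(a : ℂ_[3])‖ * ‖((PowerSeries.coeff i X : unrIntegers 3) : ℂ_[3])‖ =
      ‖(b : ℂ_[3])‖ * ‖((PowerSeries.coeff i Y : unrIntegers 3) : ℂ_[3])‖ := by
    intro i
    have hi := congrArg (PowerSeries.coeff i) h
    simp only [PowerSeries.coeff_C_mul] at hi
    have hi' := congrArg (fun z : unrIntegers 3 ↦ ‖(z : ℂ_[3])‖) hi
    simpa only [Subring.coe_mul, norm_mul] using hi'
  have ha' : 0 < ‖(a : ℂ_[3])‖ := norm_pos_iff.mpr (by simpa using ha)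
  have hb' : 0 < ‖(b : ℂ_[3])‖ := norm_pos_iff.mpr (by simpa using hb)
  rcases lt_trichotomy M M' with hlt | heq | hgt
  · exfalso
    have h1 := key M
    have h2 := key M'
    rw [hX.2, mul_one] at h1
    rw [hY.2, mul_one] at h2
    have hab : ‖(a : ℂ_[3])‖ < ‖(b : ℂ_[3])‖ := by
      rw [h1]; exact mul_lt_of_lt_one_right hb' (hY.1 M hlt)
    have hba : ‖(b : ℂ_[3])‖ ≤ ‖(a : ℂ_[3])‖ := by
      rw [← h2]; exact mul_le_of_le_one_right ha'.le (norm_coeff_le_one X M')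
    exact absurd hab (not_lt.mpr hba)
  · exact heq
  · exfalso
    have h1 := key M'
    have h2 := key M
    rw [hY.2, mul_one] at h1
    rw [hX.2, mul_one] at h2
    have hba : ‖(b : ℂ_[3])‖ < ‖(a : ℂ_[3])‖ := by
      rw [← h1]; exact mul_lt_of_lt_one_right ha' (hX.1 M' hgt)
    have hab : ‖(a : ℂ_[3])‖ ≤ ‖(b : ℂ_[3])‖ := by
      rw [h2]; exact mul_le_of_le_one_right hb'.le (norm_coeff_le_one Y M)
    exact absurd hba (not_lt.mpr hab)

/-- **Linearity turns a coefficientwise divisibility by `3` of integer sequences into a congruence `mod 𝔪_{R₀}` of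
their images under an additive functional.** [folklore] -/
theorem forall_norm_coeff_sub_lt_one_of_dvd (Θ : (ℕ → ℤ) →+ UnrSeries 3) {g g' : ℕ → ℤ}
    (hdvd : ∀ n, (3 : ℤ) ∣ g n - g' n) :
    ∀ i, ‖((PowerSeries.coeff i (Θ g - Θ g') : unrIntegers 3) : ℂ_[3])‖ < 1 := by
  choose h hh using hdvd
  have hfun : g - g' = (3 : ℤ) • (h : ℕ → ℤ) := by
    funext n
    simp only [Pi.sub_apply, Pi.smul_apply, smul_eq_mul]
    exact hh n
  intro i
  rw [← map_sub, hfun, map_zsmul, map_zsmul, zsmul_eq_mul]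
  have h3 : (((3 : ℤ) : unrIntegers 3) : ℂ_[3]) = ((3 : ℕ) : ℂ_[3]) := by push_cast; rfl
  rw [Subring.coe_mul, norm_mul, h3]
  calc ‖((3 : ℕ) : ℂ_[3])‖ * ‖((PowerSeries.coeff i (Θ h) : unrIntegers 3) : ℂ_[3])‖
      ≤ ‖((3 : ℕ) : ℂ_[3])‖ * 1 :=
        mul_le_mul_of_nonneg_left (norm_coeff_le_one _ _) (norm_nonneg _)
    _ < 1 := by rw [mul_one]; exact norm_three_lt_one

/-! ### §3 The composition: F → H → B → A, A concluded BY NAME -/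

/-- **The line's deciding composition** (no `sorry` of its own; uses exactly the three declared stubs `stub_thmBAnyLevel`,
`stub_heckeCongruence`, `stub_sqrtToricFunctional` BY NAME and concludes A BY NAME): rewrite A as the λ-identity given Thm. B (p705895 §5); the Euler products `Π_E(e), Π_{E′}(e)`
have profiles `D, D′ = Σ d_v·3^{v(e_v)}` (p615705), so `𝓛Π_E(e)` has profile `m + D` and `𝓛′Π_{E′}(e)` profile
`m′ + D′`; `Θ g_{E′}` has a profile `f′` (μ′), `Θ g_E ≡ Θ g_{E′} (mod 𝔪)` by linearity + stub H, so `Θ g_E` has profile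
`f′` too; `w·(Θ g)²` has profile `2f′` on both sides; the identities (wild)/(twin) force `m + D = 2f′ = m′ + D′`
(`profile_eq_of_C_mul_eq` — constants never evaluated), which is the λ-identity after `v(e_v) = c_v`. -/
theorem SigmaCongruenceAtThree_of : SigmaCongruenceAtThree := by
  have hB : Literature.NumberTheory.EllipticCurves.Hsieh2014.thmB_exists_isHsiehLFunction_coeff_norm_eq_one_unrPeriod_anyLevel :=
    stub_thmBAnyLevel
  have hHecke := stub_heckeCongruence
  have hΘ := stub_sqrtToricFunctional
  haveI : Fact (Nat.Prime 3) := ⟨Nat.prime_three⟩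
  rw [UniversalToricDescentSigmaCongruenceInvariantPair.sigmaCongruenceAtThree_iff_lambdaIdentity_of_thmB hB]
  intro W _ _ W' _ _ N N' _ _ K _ _ Dt Dt' hO6 hsurj hrk hN hmod haddv hN' hK hH hH' κ hκ γ _ 𝔭 h𝔭 hram
      hdeg 𝔭' h𝔭' hne ι' hι ΩK Ωp L hΩK hΩp hL ΩK' Ωp' L' hΩK' hΩp' hL' hi' T c hT hc m m' hm hm'
  obtain ⟨Θ, e, he, ⟨a, b, w, ha, hb, hw, hEq⟩, ⟨a', b', w', ha', hb', hw', hEq'⟩, hi0'⟩ :=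
    hΘ W W' N N' K Dt Dt' hO6 hsurj hrk hN hmod haddv hN' hK hH hH' κ hκ γ 𝔭 h𝔭 hram hdeg 𝔭' h𝔭' hne ι' hι ΩK Ωp L
      hΩK hΩp hL ΩK' Ωp' L' hΩK' hΩp' hL' hi' T c hT hc
  have hT3 := UniversalToricDescentSigmaCongruenceInvariantPair.not_mem_of_coe_eq hT
  -- profiles `D, D′` of the Σ-Euler products (p615705) and of `𝓛Π_E(e)`, `𝓛′Π_{E′}(e)`
  obtain ⟨-, hordE⟩ := order_map_toZMod_prod_aeval_localPolynomialAt (W.baseChange K) T hT3 e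
    (fun v hv ↦ (he v hv).1)
  obtain ⟨-, hordE'⟩ := order_map_toZMod_prod_aeval_localPolynomialAt (W'.baseChange K) T hT3 e
    (fun v hv ↦ (he v hv).1)
  have hX := normProfile_mul hm (normProfile_map_toUnr_of_order_eq _ hordE)
  have hX' := normProfile_mul hm' (normProfile_map_toUnr_of_order_eq _ hordE')
  -- `Θ g_{E′}` has a profile `f′`; `Θ g_E ≡ Θ g_{E′}` so it has profile `f′` as well
  obtain ⟨f', hF'⟩ := UniversalToricDescentSelfMuZero.exists_normProfile_of_exists_coeff_norm_eq_one hi0'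
  have hcongr := forall_norm_coeff_sub_lt_one_of_dvd Θ
    (g := fun n : ℕ ↦ if Nat.Coprime n (3 * (N * N')) then W.LFunction n else 0)
    (g' := fun n : ℕ ↦ if Nat.Coprime n (3 * (N * N')) then W'.LFunction n else 0)
    (fun n ↦ by
      show (3 : ℤ) ∣ (if Nat.Coprime n (3 * (N * N')) then W.LFunction n else 0) -
        (if Nat.Coprime n (3 * (N * N')) then W'.LFunction n else 0)
      by_cases hn : Nat.Coprime n (3 * (N * N'))
      · rw [if_pos hn, if_pos hn]; exact hHecke W W' N N' hN hN' hmod n hn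
      · rw [if_neg hn, if_neg hn, sub_zero]; exact dvd_zero 3)
  have hF := normProfile_of_forall_norm_sub_lt hcongr hF'
  -- `w·(Θ g_E)²` and `w′·(Θ g_{E′})²` have profile `f′ + f′`
  have hF2 := normProfile_mul hF hF
  have hF2' := normProfile_mul hF' hF'
  rw [← sq] at hF2 hF2'
  have hwF2 := normProfile_mul_of_isUnit hw hF2
  have hwF2' := normProfile_mul_of_isUnit hw' hF2'
  -- the constants are invisible: `m + D = f′ + f′ = m′ + D′`
  have h1 := profile_eq_of_C_mul_eq ha hb hX hwF2 hEq
  have h2 := profile_eq_of_C_mul_eq ha' hb' hX' hwF2' hEq'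
  -- `d_v · 3^{v(e_v)} = 3^{c_v} · d_v` place by place
  have key : ∀ E : WeierstrassCurve K,
      ∑ v ∈ T, (eulerFactorModP E 3 v).rootMultiplicity
            (((Nat.card (IsLocalRing.ResidueField (v.adicCompletionIntegers K)) : ℕ) : ZMod 3)⁻¹) *
          3 ^ (e v).valuation =
        ∑ v ∈ T, 3 ^ c v * (eulerFactorModP E 3 v).rootMultiplicity
            (((Nat.card (IsLocalRing.ResidueField (v.adicCompletionIntegers K)) : ℕ) : ZMod 3)⁻¹) :=
    fun E ↦ Finset.sum_congr rfl fun v hv ↦ by rw [(he v hv).2, mul_comm]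
  rw [← key, ← key]
  omega

end Summit.BirchSwinnertonDyer.BirchSwinnertonDyer.Cruxes.SigmaCongruenceAtThree.SqrtToricFunctional

end
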